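import Summits.QuantumFields.BalabanUV.Beta.GAN24.DerivativeRateTransferLoewnerGram

/-!
# `BalabanUV.Beta.GAN24.DerivativeRateTransferLoewnerGramSchedule` — binder row G-an2-4 ∕ (CONV-C), route R6 «VALUES, NOT DERIVATIVES», PART 88:
# PART 20's TOWER END UNDER A PETER–PAUL FAMILY WITH THREE SCHEDULES — the (STAB) datum as the per-level suppliers actually produce it (PART 56 ∕ 83 ∕ 84:
# for EVERY `s > 0`, `Qf_jᵀ H_j Qf_j ≤ (1+s)(1 + e_j)·H_{j+1} + (1+s⁻¹)·τ_j²·G_{j+1}`), a POLAR-SLACK schedule `e_j ≤ E₀·θ_p^j`, a LINK-MISMATCH schedule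
# `τ_j ≤ M₀·θ_m^j`, a Gram-mass GROWTH letter `|(ℋ_jᵀ G_j ℋ_j)_{ab}| ≤ N₀·Λ^j` (NOT k-uniform), and ONE inequality `θ_m²·Λ ≤ θ²` ⟹ the entry one-step rate
# `|𝒮_{j+1}(a,b) − 𝒮_j(a,b)| ≤ (cst + 2(1 + 2E₀)·B + 4M₀²N₀Λ)·θ^j` with the choice `s_j = θ^j`, and the entrywise limit `𝒮_∞` with the (CONV-C)-shaped tail
# `C·θ^j∕(1 − θ)` (unit b2b-balaban-gan24-p3, gen 47; v1 — the abstract half of gan24-idea-1 g62's request (G) ∕ g63 LENS ITEM 20 «keep θ_m a FREE parameter»)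

NOT IN PRINT; OUR PROOF (for the ROUTE; [folklore] finite-dimensional linear algebra over `ℝ` + geometric series — PART 20's two-level letters
`abs_effForm_step_le_of_stabGram_of_cons` ∕ `leg_energy_le_of_stabGram_of_cons` BY NAME, Mathlib `cauchySeq_of_le_geometric` ∕ `dist_le_of_le_geometric_of_tendsto`).
HONEST FRAMING (cell contract, verbatim): «discharging `BetaPertH` makes Bałaban's UV stability UNCONDITIONAL — a real constructive-QFT result; it is NOT the
continuum limit and NOT the Clay problem.»  HONEST DEPENDENCY (verbatim): «continuum YM on T⁴ ⇐ BetaPertH ∧ nine spine estimates (0/9 proved); BetaPertH ⇐ (D1) ∧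
(D4) ∧ CAP+tail; G-an2-4 gates asym, D1 and NE2/3/4.»

WHY THIS FILE.  PART 20's END `effForm_entry_step_rate_of_stabGram_of_cons` consumes ONE inequality per level, (STAB-ε_j,δ_j) with `ε_j = cε·θ^j`, `δ_j = cδ·θ^j`,
and a k-UNIFORM Gram mass `N`.  The suppliers of record deliver something else: PART 56 (`posSemidef_covJensen_transfer_of_polar`) and PARTs 83 ∕ 84 (the
(1.27) ∕ (1.29) pair on the block lattice) give, at each level, a FAMILY in the free Peter–Paul parameter `s > 0` — multiplicative slack `(1+s)(1 + e_j)` with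
`e_j` the polar pair's relative slack (first order in the holonomy ∕ plaquette letter, PART 56 §1), additive slack `(1+s⁻¹)·τ_j²` times a mass form, `τ_j` the
bond-by-bond discrepancy between the coarse connection the fine field produces and the one `H_j` is built on (the convention defect of PARTs 70 ∕ 77 PLUS the
tower's inter-level link mismatch — they add, PART 89 §3) — and the Gram mass of the unit-source minimiser columns in that form GROWS along the tower
(`N_j ≤ N₀Λ^j`; in the energy normalisation pinned by PART 85's weight row `w_c·L·(L·(L^d)⁻¹) ≤ w_f` and PART 20's k-uniform `hB`, a free-field support
COUNT — not a theorem; `R6-SCHEDULE-NOTE.md` §3 with a numerical toy — gives `Λ = L²` in every `d`: the level weights go like `L^{(2−d)j}` and the one-step block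
means of a unit-source minimiser column occupy `≍ L^{dj}` sites with `O(1)` values).
Matching PART 20's letters forces `s_j ≤ cε·θ^j` and `(1+s_j⁻¹)·τ_j²·N_{j+1} ≤ cδN·θ^j`; both hold for some `s_j` at every level IFF `θ_m²·Λ ≤ θ²`
(`s_j ∈ [(θ_m²Λ∕θ)^j, θ^j]`), and then `s_j := θ^j` does it.  THIS FILE types exactly that bookkeeping, with `θ_m` a FREE parameter (gan24-idea-1 g63 LENS 20: the
END needs SOME link-mismatch exponent making `θ_m²Λ < 1`, not tier B's `hmc`; with `Λ = L²`: `θ_m < L⁻¹`, e.g. `θ_m = L^{−4∕3}` gives the rate `θ = L^{−1∕3}`).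

WHAT THIS FILE PROVES (0 sorry, 0 `def`, nothing cited):
* §1 `mulSlack_le` (`(1 + θ^j)(1 + e) − 1 ≤ (1 + 2E₀)·θ^j` for `0 ≤ e ≤ E₀θ_p^j`, `θ_p ≤ θ ≤ 1`), `addSlack_le`
  (`(1 + θ^{−j})·(M₀θ_m^j)²·(N₀Λ^{j+1}) ≤ 2M₀²N₀Λ·θ^j` under `θ_m²Λ ≤ θ²`, `0 < θ ≤ 1`) — the two scalar schedule letters.
* §2 `abs_effForm_step_le_of_stabPP`, `leg_energy_le_of_stabPP` — PART 20's two-level letters at ONE member `s` of the Peter–Paul family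
  (`ε = (1+s)(1+e) − 1`, `δ = (1+s⁻¹)·a`).
* §3 **`towerEnd_of_stabFamily_of_schedules`** — THE SCHEDULED TOWER END: PART 20's structural hypotheses (`hH`, `hk`, `hcomp`, `hPQ`, `hG`), (CONS_{j,y}) `≤ cst·θ^j`,
  k-uniform `|𝒮_j(a,b)| ≤ B`, the family `∀ s > 0, 0 ≤ ((1+s)(1+e_j))•H_{j+1} + ((1+s⁻¹)τ_j²)•G_{j+1} − Qf_jᵀH_jQf_j`, schedules `0 ≤ e_j ≤ E₀θ_p^j`,
  `0 ≤ τ_j ≤ M₀θ_m^j`, growth `|(ℋ_jᵀG_jℋ_j)_{ab}| ≤ N₀Λ^j`, signs `0 < θ ≤ 1`, `0 ≤ θ_p ≤ θ`, `0 ≤ E₀, N₀, Λ`, and `hrate : θ_m²·Λ ≤ θ²` ⟹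
  `∀ j a b, |𝒮_{j+1}(a,b) − 𝒮_j(a,b)| ≤ (cst + 2(1 + 2E₀)B + 4M₀²N₀Λ)·θ^j`; `leg_energy_rate_of_stabFamily_of_schedules` (the minimiser legs in energy currency,
  `≤ (cst + (1 + 2E₀)B + 2M₀²N₀Λ)·θ^j`).
* §4 `exists_limit_of_step_rate_real` ([folklore] a real one-step rate `C·θ^j`, `θ < 1` ⟹ a limit with tail `C·θ^j∕(1−θ)`),
  **`exists_effForm_limit_of_stabFamily_of_schedules`** (+ `θ < 1` ⟹ `∃ 𝒮_∞`, entrywise limit of the effective forms, `|𝒮_j(a,b) − 𝒮_∞(a,b)| ≤ C·θ^j∕(1−θ)` —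
  the shape of (CONV-C) ∕ `LimitForm.conv`, constants `(cst, E₀, B, M₀, N₀, Λ, θ)` only).
WHAT IT DOES NOT DO: produce the family, the schedules or the growth letter for any of Bałaban's operators (PART 89 threads PART 56's `(s,t,r)`-family and the
lattice letters of PARTs 84 ∕ 85 into §3; the mismatch schedule `τ_j ≤ M₀θ_m^j` for the TOWER's pair and the count `Λ` are consumer inputs — gan24-idea-1 g63
LENS 20 names print + R9° + NE3's interpolation leaf for `θ_m = L^{−4∕3}`, NOT typed); touch (CONS) ∕ S2.  SUPPLIER work on route R6 (rank 2, REDUCTION, no seat);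
no consumer of record; NEVER «G-an2-4 closed»; NOT (CONV-C), NOT D1, NOT `BetaPertH`, NOT continuum, NOT Clay.  Records: `HOME/b2b-balaban-gan24-p3/WOODBURY-FIBRE.md`
v14.7, `HOME/beta/ROUTES-GAN24.md` v63 l.903 (G) ∕ l.905.
-/

noncomputable section

open Set Matrix Filter Topology

namespace Summit.QuantumFields.BalabanUV.Beta.GAN24.DerivativeRateTransferLoewnerGramSchedule

open Literature.MathematicalPhysics.QuantumFieldTheory.Balaban1983to89.Beta.Composition (kkt)
open Literature.MathematicalPhysics.QuantumFieldTheory.Balaban1983to89.Beta.CompositionSingular (effForm minOp)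
open Summit.QuantumFields.BalabanUV.Beta.GAN24.DerivativeRateTransferLoewnerGram (abs_effForm_step_le_of_stabGram_of_cons
  leg_energy_le_of_stabGram_of_cons)

/-! ## §1 The two scalar schedule letters -/

section Scalar

/-- **THE MULTIPLICATIVE SLACK AT `s = θ^j`** [folklore arithmetic]: `0 < θ ≤ 1`, `0 ≤ θ_p ≤ θ`, `0 ≤ E₀`, `0 ≤ e ≤ E₀·θ_p^j` ⟹
`(1 + θ^j)(1 + e) − 1 ≤ (1 + 2E₀)·θ^j`. -/
theorem mulSlack_le {θ θp e E₀ : ℝ} {j : ℕ} (hθ : 0 < θ) (hθ1 : θ ≤ 1) (hθp : 0 ≤ θp) (hθpθ : θp ≤ θ) (hE₀ : 0 ≤ E₀)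
    (he : 0 ≤ e) (heE : e ≤ E₀ * θp ^ j) : (1 + θ ^ j) * (1 + e) - 1 ≤ (1 + 2 * E₀) * θ ^ j := by
  have hθj1 : θ ^ j ≤ 1 := pow_le_one₀ hθ.le hθ1
  have hpj : θp ^ j ≤ θ ^ j := pow_le_pow_left₀ hθp hθpθ j
  have h1 : e ≤ E₀ * θ ^ j := heE.trans (mul_le_mul_of_nonneg_left hpj hE₀)
  have h2 : θ ^ j * e ≤ e := by
    have := mul_le_mul_of_nonneg_right hθj1 he
    rwa [one_mul] at this
  nlinarith

/-- **THE ADDITIVE SLACK AT `s = θ^j` AGAINST THE GROWTH LETTER** [folklore arithmetic]: `0 < θ ≤ 1`, `0 ≤ Λ`, `0 ≤ N₀`, `θ_m²·Λ ≤ θ²` ⟹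
`(1 + (θ^j)⁻¹)·(M₀θ_m^j)²·(N₀Λ^{j+1}) ≤ 2·(M₀²N₀Λ)·θ^j` — the mismatch schedule squared times the Gram-mass growth is summable against `θ^j` exactly when
`θ_m²Λ ≤ θ²`. -/
theorem addSlack_le {θ θm Λ M₀ N₀ : ℝ} {j : ℕ} (hθ : 0 < θ) (hθ1 : θ ≤ 1) (hΛ : 0 ≤ Λ) (hN₀ : 0 ≤ N₀) (hrate : θm ^ 2 * Λ ≤ θ ^ 2) :
    (1 + (θ ^ j)⁻¹) * (M₀ * θm ^ j) ^ 2 * (N₀ * Λ ^ (j + 1)) ≤ 2 * (M₀ ^ 2 * N₀ * Λ) * θ ^ j := by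
  have hθj : 0 < θ ^ j := pow_pos hθ j
  have hθj1 : θ ^ j ≤ 1 := pow_le_one₀ hθ.le hθ1
  have hq0 : 0 ≤ θm ^ 2 * Λ := mul_nonneg (sq_nonneg _) hΛ
  have hq : (θm ^ 2 * Λ) ^ j ≤ (θ ^ 2) ^ j := pow_le_pow_left₀ hq0 hrate j
  have e1 : (M₀ * θm ^ j) ^ 2 * (N₀ * Λ ^ (j + 1)) = M₀ ^ 2 * N₀ * Λ * (θm ^ 2 * Λ) ^ j := by
    rw [mul_pow (θm ^ 2) Λ j, ← pow_mul, mul_comm 2 j, pow_mul]; ring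
  have hX : 0 ≤ M₀ ^ 2 * N₀ * Λ := by positivity
  have h1 : 1 + (θ ^ j)⁻¹ ≤ 2 * (θ ^ j)⁻¹ := by
    have : 1 ≤ (θ ^ j)⁻¹ := (one_le_inv₀ hθj).mpr hθj1
    linarith
  have e2 : (θ ^ 2) ^ j = θ ^ j * θ ^ j := by rw [← pow_mul, mul_comm 2 j, pow_mul, sq]
  calc (1 + (θ ^ j)⁻¹) * (M₀ * θm ^ j) ^ 2 * (N₀ * Λ ^ (j + 1))
      = (1 + (θ ^ j)⁻¹) * (M₀ ^ 2 * N₀ * Λ * (θm ^ 2 * Λ) ^ j) := by rw [mul_assoc, e1]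
    _ ≤ (2 * (θ ^ j)⁻¹) * (M₀ ^ 2 * N₀ * Λ * (θ ^ 2) ^ j) :=
        mul_le_mul h1 (mul_le_mul_of_nonneg_left hq hX) (by positivity) (by positivity)
    _ = 2 * (M₀ ^ 2 * N₀ * Λ) * θ ^ j := by
        rw [e2]; field_simp

end Scalar

/-! ## §2 PART 20's two-level letters at one member of the Peter–Paul family -/

section TwoLevels

variable {c ν ν' : Type*} [Fintype c] [Fintype ν] [Fintype ν'] [DecidableEq c] [DecidableEq ν] [DecidableEq ν']
variable {H : Matrix ν ν ℝ} {Q : Matrix c ν ℝ} {H' : Matrix ν' ν' ℝ} {Q' : Matrix c ν' ℝ} {Qf : Matrix ν ν' ℝ} {P : Matrix ν' ν ℝ}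
variable {G : Matrix ν' ν' ℝ} {e a s : ℝ}

/-- **`abs_effForm_step_le_of_stabPP` — THE TWO-LEVEL ENTRY BOUND AT ONE PETER–PAUL PARAMETER** [our proof; PART 20 BY NAME]: fine forms PSD, bordered matrices
nonsingular, `Q′ = Q·Qf`, `Q′P = Q`, `Gᵀ = G`, `0 < s`, `0 ≤ e`, `0 ≤ a`, `0 ≤ ((1+s)(1+e))•H′ + ((1+s⁻¹)a)•G − QfᵀHQf`, (CONS ≤ κ), `|𝒮′_{ab}| ≤ B`,
`|(ℋ′ᵀGℋ′)_{ab}| ≤ N` ⟹ `|𝒮′_{ab} − 𝒮_{ab}| ≤ κ + 2((1+s)(1+e) − 1)·B + 2((1+s⁻¹)a)·N`. -/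
theorem abs_effForm_step_le_of_stabPP (hH : H.PosSemidef) (hH' : H'.PosSemidef) (h : IsUnit (kkt H Q).det)
    (h' : IsUnit (kkt H' Q').det) (hcomp : Q' = Q * Qf) (hPQ : Q' * P = Q) (hG : Gᵀ = G) {κ B N : ℝ} (hs : 0 < s) (he : 0 ≤ e) (ha : 0 ≤ a)
    (hstab : (((1 + s) * (1 + e)) • H' + ((1 + s⁻¹) * a) • G - Qfᵀ * H * Qf).PosSemidef)
    (hcons : ∀ y, (minOp H Q *ᵥ Pi.single y 1) ⬝ᵥ ((Pᵀ * H' * P - H) *ᵥ (minOp H Q *ᵥ Pi.single y 1)) ≤ κ)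
    (hB : ∀ a b, |effForm H' Q' a b| ≤ B) (hN : ∀ a b, |((minOp H' Q')ᵀ * G * minOp H' Q') a b| ≤ N) (x y : c) :
    |effForm H' Q' x y - effForm H Q x y| ≤ κ + 2 * ((1 + s) * (1 + e) - 1) * B + 2 * ((1 + s⁻¹) * a) * N := by
  have hε : 0 ≤ (1 + s) * (1 + e) - 1 := by nlinarith
  have hδ : 0 ≤ (1 + s⁻¹) * a := by positivity
  have hstab' : ((1 + ((1 + s) * (1 + e) - 1)) • H' + ((1 + s⁻¹) * a) • G - Qfᵀ * H * Qf).PosSemidef := by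
    have e1 : (1 + ((1 + s) * (1 + e) - 1)) = (1 + s) * (1 + e) := by ring
    rw [e1]; exact hstab
  exact abs_effForm_step_le_of_stabGram_of_cons hH hH' h h' hcomp hPQ hG hε hδ hstab' hcons hB hN x y

/-- **`leg_energy_le_of_stabPP` — THE MINIMISER LEG IN ENERGY CURRENCY AT ONE PETER–PAUL PARAMETER** [our proof; PART 20 BY NAME]: under the same hypotheses
`⟨Pℋe_y − ℋ′e_y, H′(Pℋe_y − ℋ′e_y)⟩ ≤ κ + ((1+s)(1+e) − 1)·B + ((1+s⁻¹)a)·N`. -/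
theorem leg_energy_le_of_stabPP (hH : H.PosSemidef) (hH' : H'.PosSemidef) (h : IsUnit (kkt H Q).det)
    (h' : IsUnit (kkt H' Q').det) (hcomp : Q' = Q * Qf) (hPQ : Q' * P = Q) (hG : Gᵀ = G) {κ B N : ℝ} (hs : 0 < s) (he : 0 ≤ e) (ha : 0 ≤ a)
    (hstab : (((1 + s) * (1 + e)) • H' + ((1 + s⁻¹) * a) • G - Qfᵀ * H * Qf).PosSemidef)
    (hcons : ∀ y, (minOp H Q *ᵥ Pi.single y 1) ⬝ᵥ ((Pᵀ * H' * P - H) *ᵥ (minOp H Q *ᵥ Pi.single y 1)) ≤ κ)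
    (hB : ∀ a b, |effForm H' Q' a b| ≤ B) (hN : ∀ a b, |((minOp H' Q')ᵀ * G * minOp H' Q') a b| ≤ N) (y : c) :
    (P *ᵥ (minOp H Q *ᵥ Pi.single y 1) - minOp H' Q' *ᵥ Pi.single y 1) ⬝ᵥ
        (H' *ᵥ (P *ᵥ (minOp H Q *ᵥ Pi.single y 1) - minOp H' Q' *ᵥ Pi.single y 1)) ≤
      κ + ((1 + s) * (1 + e) - 1) * B + ((1 + s⁻¹) * a) * N := by
  have hε : 0 ≤ (1 + s) * (1 + e) - 1 := by nlinarith
  have hδ : 0 ≤ (1 + s⁻¹) * a := by positivity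
  have hstab' : ((1 + ((1 + s) * (1 + e) - 1)) • H' + ((1 + s⁻¹) * a) • G - Qfᵀ * H * Qf).PosSemidef := by
    have e1 : (1 + ((1 + s) * (1 + e) - 1)) = (1 + s) * (1 + e) := by ring
    rw [e1]; exact hstab
  exact leg_energy_le_of_stabGram_of_cons hH hH' h h' hcomp hPQ hG hε hδ hstab' hcons hB hN y

end TwoLevels

/-! ## §3 THE SCHEDULED TOWER END -/

section Tower

variable {c : Type*} [Fintype c] [DecidableEq c]
variable {ι : ℕ → Type*} [∀ j, Fintype (ι j)] [∀ j, DecidableEq (ι j)]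
variable {H : ∀ j, Matrix (ι j) (ι j) ℝ} {Qf : ∀ j, Matrix (ι j) (ι (j + 1)) ℝ} {Qc : ∀ j, Matrix c (ι j) ℝ}
variable {P : ∀ j, Matrix (ι (j + 1)) (ι j) ℝ} {G : ∀ j, Matrix (ι j) (ι j) ℝ} {e τ : ℕ → ℝ} {cst B E₀ M₀ N₀ Λ θ θp θm : ℝ}

/-- **`towerEnd_of_stabFamily_of_schedules` — PART 20's TOWER END UNDER A PETER–PAUL FAMILY WITH THREE SCHEDULES** [our proof].  Tower of PSD fine forms `H j`
(`j + 1` finer than `j`), nonsingular bordered matrices, `Qc (j+1) = Qc j · Qf j`, `Qc (j+1) · P j = Qc j`, symmetric mass forms `G j`; (CONS_{j,y}) `≤ cst·θ^j`;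
k-uniform `|𝒮_j(a,b)| ≤ B`; the (STAB) FAMILY `∀ s > 0, 0 ≤ ((1+s)(1 + e_j))•H_{j+1} + ((1+s⁻¹)·τ_j²)•G_{j+1} − Qf_jᵀH_jQf_j` (PART 56's shape, `G_{j+1}`
absorbing `w_c·d′`); the POLAR-SLACK schedule `0 ≤ e_j ≤ E₀·θ_p^j`; the MISMATCH schedule `0 ≤ τ_j ≤ M₀·θ_m^j`; the GROWTH letter
`|(ℋ_jᵀG_jℋ_j)_{ab}| ≤ N₀·Λ^j`; `0 < θ ≤ 1`, `0 ≤ θ_p ≤ θ`, `0 ≤ E₀, N₀, Λ`; and **`hrate : θ_m²·Λ ≤ θ²`** ⟹ for all `j, a, b`: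
`|𝒮_{j+1}(a,b) − 𝒮_j(a,b)| ≤ (cst + 2(1 + 2E₀)·B + 4·M₀²N₀Λ)·θ^j` (the choice `s_j = θ^j`; `θ_m` is a FREE parameter). -/
theorem towerEnd_of_stabFamily_of_schedules (hH : ∀ j, (H j).PosSemidef) (hk : ∀ j, IsUnit (kkt (H j) (Qc j)).det)
    (hcomp : ∀ j, Qc (j + 1) = Qc j * Qf j) (hPQ : ∀ j, Qc (j + 1) * P j = Qc j) (hG : ∀ j, (G j)ᵀ = G j)
    (hstab : ∀ j (s : ℝ), 0 < s →
      ((((1 + s) * (1 + e j)) • H (j + 1) + ((1 + s⁻¹) * τ j ^ 2) • G (j + 1) - (Qf j)ᵀ * H j * Qf j).PosSemidef))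
    (hcons : ∀ j (y : c), (minOp (H j) (Qc j) *ᵥ Pi.single y 1) ⬝ᵥ
        (((P j)ᵀ * H (j + 1) * P j - H j) *ᵥ (minOp (H j) (Qc j) *ᵥ Pi.single y 1)) ≤ cst * θ ^ j)
    (hB : ∀ j a b, |effForm (H j) (Qc j) a b| ≤ B)
    (he : ∀ j, 0 ≤ e j ∧ e j ≤ E₀ * θp ^ j) (hτ : ∀ j, 0 ≤ τ j ∧ τ j ≤ M₀ * θm ^ j)
    (hN : ∀ j a b, |((minOp (H j) (Qc j))ᵀ * G j * minOp (H j) (Qc j)) a b| ≤ N₀ * Λ ^ j)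
    (hθ : 0 < θ) (hθ1 : θ ≤ 1) (hθp : 0 ≤ θp) (hθpθ : θp ≤ θ) (hE₀ : 0 ≤ E₀) (hN₀ : 0 ≤ N₀) (hΛ : 0 ≤ Λ)
    (hrate : θm ^ 2 * Λ ≤ θ ^ 2) :
    ∀ j (a b : c), |effForm (H (j + 1)) (Qc (j + 1)) a b - effForm (H j) (Qc j) a b| ≤
      (cst + 2 * (1 + 2 * E₀) * B + 4 * (M₀ ^ 2 * N₀ * Λ)) * θ ^ j := by
  intro j a b
  have hθj : 0 < θ ^ j := pow_pos hθ j
  have hB0 : 0 ≤ B := (abs_nonneg _).trans (hB j a b)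
  have h := abs_effForm_step_le_of_stabPP (hH j) (hH (j + 1)) (hk j) (hk (j + 1)) (hcomp j) (hPQ j) (hG (j + 1)) hθj (he j).1
    (sq_nonneg (τ j)) (hstab j (θ ^ j) hθj) (hcons j) (fun a b => hB (j + 1) a b) (fun a b => hN (j + 1) a b) a b
  -- the two schedule letters
  have hmul : 2 * ((1 + θ ^ j) * (1 + e j) - 1) * B ≤ 2 * (1 + 2 * E₀) * B * θ ^ j := by
    have := mul_le_mul_of_nonneg_right (mulSlack_le hθ hθ1 hθp hθpθ hE₀ (he j).1 (he j).2) hB0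
    nlinarith
  have hadd : 2 * ((1 + (θ ^ j)⁻¹) * τ j ^ 2) * (N₀ * Λ ^ (j + 1)) ≤ 4 * (M₀ ^ 2 * N₀ * Λ) * θ ^ j := by
    have hτ2 : τ j ^ 2 ≤ (M₀ * θm ^ j) ^ 2 := pow_le_pow_left₀ (hτ j).1 (hτ j).2 2
    have hs' : 0 ≤ 1 + (θ ^ j)⁻¹ := by positivity
    have hNΛ : 0 ≤ N₀ * Λ ^ (j + 1) := by positivity
    have h1 : (1 + (θ ^ j)⁻¹) * τ j ^ 2 * (N₀ * Λ ^ (j + 1)) ≤ (1 + (θ ^ j)⁻¹) * (M₀ * θm ^ j) ^ 2 * (N₀ * Λ ^ (j + 1)) :=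
      mul_le_mul_of_nonneg_right (mul_le_mul_of_nonneg_left hτ2 hs') hNΛ
    have h2 := addSlack_le (M₀ := M₀) (N₀ := N₀) (j := j) hθ hθ1 hΛ hN₀ hrate
    nlinarith
  calc |effForm (H (j + 1)) (Qc (j + 1)) a b - effForm (H j) (Qc j) a b|
      ≤ cst * θ ^ j + 2 * ((1 + θ ^ j) * (1 + e j) - 1) * B + 2 * ((1 + (θ ^ j)⁻¹) * τ j ^ 2) * (N₀ * Λ ^ (j + 1)) := h
    _ ≤ cst * θ ^ j + 2 * (1 + 2 * E₀) * B * θ ^ j + 4 * (M₀ ^ 2 * N₀ * Λ) * θ ^ j := by linarith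
    _ = (cst + 2 * (1 + 2 * E₀) * B + 4 * (M₀ ^ 2 * N₀ * Λ)) * θ ^ j := by ring

/-- **`leg_energy_rate_of_stabFamily_of_schedules` — THE MINIMISER LEGS IN ENERGY CURRENCY FROM THE SAME DATA** [our proof]: under the hypotheses of
`towerEnd_of_stabFamily_of_schedules`, `⟨P_jℋ_je_y − ℋ_{j+1}e_y, H_{j+1}(P_jℋ_je_y − ℋ_{j+1}e_y)⟩ ≤ (cst + (1 + 2E₀)·B + 2·M₀²N₀Λ)·θ^j` for all `j, y`. -/
theorem leg_energy_rate_of_stabFamily_of_schedules (hH : ∀ j, (H j).PosSemidef) (hk : ∀ j, IsUnit (kkt (H j) (Qc j)).det)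
    (hcomp : ∀ j, Qc (j + 1) = Qc j * Qf j) (hPQ : ∀ j, Qc (j + 1) * P j = Qc j) (hG : ∀ j, (G j)ᵀ = G j)
    (hstab : ∀ j (s : ℝ), 0 < s →
      ((((1 + s) * (1 + e j)) • H (j + 1) + ((1 + s⁻¹) * τ j ^ 2) • G (j + 1) - (Qf j)ᵀ * H j * Qf j).PosSemidef))
    (hcons : ∀ j (y : c), (minOp (H j) (Qc j) *ᵥ Pi.single y 1) ⬝ᵥ
        (((P j)ᵀ * H (j + 1) * P j - H j) *ᵥ (minOp (H j) (Qc j) *ᵥ Pi.single y 1)) ≤ cst * θ ^ j)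
    (hB : ∀ j a b, |effForm (H j) (Qc j) a b| ≤ B)
    (he : ∀ j, 0 ≤ e j ∧ e j ≤ E₀ * θp ^ j) (hτ : ∀ j, 0 ≤ τ j ∧ τ j ≤ M₀ * θm ^ j)
    (hN : ∀ j a b, |((minOp (H j) (Qc j))ᵀ * G j * minOp (H j) (Qc j)) a b| ≤ N₀ * Λ ^ j)
    (hθ : 0 < θ) (hθ1 : θ ≤ 1) (hθp : 0 ≤ θp) (hθpθ : θp ≤ θ) (hE₀ : 0 ≤ E₀) (hN₀ : 0 ≤ N₀) (hΛ : 0 ≤ Λ)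
    (hrate : θm ^ 2 * Λ ≤ θ ^ 2) :
    ∀ j (y : c), (P j *ᵥ (minOp (H j) (Qc j) *ᵥ Pi.single y 1) - minOp (H (j + 1)) (Qc (j + 1)) *ᵥ Pi.single y 1) ⬝ᵥ
        (H (j + 1) *ᵥ (P j *ᵥ (minOp (H j) (Qc j) *ᵥ Pi.single y 1) - minOp (H (j + 1)) (Qc (j + 1)) *ᵥ Pi.single y 1)) ≤
      (cst + (1 + 2 * E₀) * B + 2 * (M₀ ^ 2 * N₀ * Λ)) * θ ^ j := by
  intro j y
  have hθj : 0 < θ ^ j := pow_pos hθ j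
  have hB0 : 0 ≤ B := (abs_nonneg _).trans (hB j y y)
  have h := leg_energy_le_of_stabPP (hH j) (hH (j + 1)) (hk j) (hk (j + 1)) (hcomp j) (hPQ j) (hG (j + 1)) hθj (he j).1
    (sq_nonneg (τ j)) (hstab j (θ ^ j) hθj) (hcons j) (fun a b => hB (j + 1) a b) (fun a b => hN (j + 1) a b) y
  have hmul : ((1 + θ ^ j) * (1 + e j) - 1) * B ≤ (1 + 2 * E₀) * B * θ ^ j := by
    have := mul_le_mul_of_nonneg_right (mulSlack_le hθ hθ1 hθp hθpθ hE₀ (he j).1 (he j).2) hB0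
    nlinarith
  have hadd : ((1 + (θ ^ j)⁻¹) * τ j ^ 2) * (N₀ * Λ ^ (j + 1)) ≤ 2 * (M₀ ^ 2 * N₀ * Λ) * θ ^ j := by
    have hτ2 : τ j ^ 2 ≤ (M₀ * θm ^ j) ^ 2 := pow_le_pow_left₀ (hτ j).1 (hτ j).2 2
    have hs' : 0 ≤ 1 + (θ ^ j)⁻¹ := by positivity
    have hNΛ : 0 ≤ N₀ * Λ ^ (j + 1) := by positivity
    have h1 : (1 + (θ ^ j)⁻¹) * τ j ^ 2 * (N₀ * Λ ^ (j + 1)) ≤ (1 + (θ ^ j)⁻¹) * (M₀ * θm ^ j) ^ 2 * (N₀ * Λ ^ (j + 1)) :=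
      mul_le_mul_of_nonneg_right (mul_le_mul_of_nonneg_left hτ2 hs') hNΛ
    have h2 := addSlack_le (M₀ := M₀) (N₀ := N₀) (j := j) hθ hθ1 hΛ hN₀ hrate
    nlinarith
  calc _ ≤ cst * θ ^ j + ((1 + θ ^ j) * (1 + e j) - 1) * B + ((1 + (θ ^ j)⁻¹) * τ j ^ 2) * (N₀ * Λ ^ (j + 1)) := h
    _ ≤ cst * θ ^ j + (1 + 2 * E₀) * B * θ ^ j + 2 * (M₀ ^ 2 * N₀ * Λ) * θ ^ j := by linarith
    _ = (cst + (1 + 2 * E₀) * B + 2 * (M₀ ^ 2 * N₀ * Λ)) * θ ^ j := by ring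

end Tower

/-! ## §4 The entrywise limit with the (CONV-C)-shaped tail -/

section Limit

/-- [folklore] **A REAL ONE-STEP RATE GIVES A LIMIT WITH A GEOMETRIC TAIL**: `|f(j+1) − f(j)| ≤ C·θ^j` for all `j` and `θ < 1` ⟹ `∃ l`, `f → l` and
`|f(j) − l| ≤ C·θ^j∕(1 − θ)` for all `j` (Mathlib `cauchySeq_of_le_geometric` ∕ `dist_le_of_le_geometric_of_tendsto`; no sign condition on `θ`). -/
theorem exists_limit_of_step_rate_real (f : ℕ → ℝ) {C θ : ℝ} (hθ1 : θ < 1) (h : ∀ j, |f (j + 1) - f j| ≤ C * θ ^ j) :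
    ∃ l : ℝ, Tendsto f atTop (𝓝 l) ∧ ∀ j, |f j - l| ≤ C * θ ^ j / (1 - θ) := by
  have hd : ∀ j, dist (f j) (f (j + 1)) ≤ C * θ ^ j := fun j => by
    rw [dist_comm, Real.dist_eq]; exact h j
  obtain ⟨l, hl⟩ := cauchySeq_tendsto_of_complete (cauchySeq_of_le_geometric θ C hθ1 hd)
  refine ⟨l, hl, fun j => ?_⟩
  rw [← Real.dist_eq]
  exact dist_le_of_le_geometric_of_tendsto θ C hθ1 hd hl j

variable {c : Type*} [Fintype c] [DecidableEq c]
variable {ι : ℕ → Type*} [∀ j, Fintype (ι j)] [∀ j, DecidableEq (ι j)]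
variable {H : ∀ j, Matrix (ι j) (ι j) ℝ} {Qf : ∀ j, Matrix (ι j) (ι (j + 1)) ℝ} {Qc : ∀ j, Matrix c (ι j) ℝ}
variable {P : ∀ j, Matrix (ι (j + 1)) (ι j) ℝ} {G : ∀ j, Matrix (ι j) (ι j) ℝ} {e τ : ℕ → ℝ} {cst B E₀ M₀ N₀ Λ θ θp θm : ℝ}

/-- **`exists_effForm_limit_of_stabFamily_of_schedules` — THE LIMIT FORM WITH THE (CONV-C)-SHAPED TAIL** [our proof]: under the hypotheses of
`towerEnd_of_stabFamily_of_schedules` and `θ < 1` there is `𝒮_∞ : Matrix c c ℝ` with `𝒮_j(a,b) → 𝒮_∞(a,b)` and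
`|𝒮_j(a,b) − 𝒮_∞(a,b)| ≤ (cst + 2(1 + 2E₀)B + 4M₀²N₀Λ)·θ^j∕(1 − θ)` for all `j, a, b` — constants `(cst, E₀, B, M₀, N₀, Λ, θ)` only. -/
theorem exists_effForm_limit_of_stabFamily_of_schedules (hH : ∀ j, (H j).PosSemidef) (hk : ∀ j, IsUnit (kkt (H j) (Qc j)).det)
    (hcomp : ∀ j, Qc (j + 1) = Qc j * Qf j) (hPQ : ∀ j, Qc (j + 1) * P j = Qc j) (hG : ∀ j, (G j)ᵀ = G j)
    (hstab : ∀ j (s : ℝ), 0 < s →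
      ((((1 + s) * (1 + e j)) • H (j + 1) + ((1 + s⁻¹) * τ j ^ 2) • G (j + 1) - (Qf j)ᵀ * H j * Qf j).PosSemidef))
    (hcons : ∀ j (y : c), (minOp (H j) (Qc j) *ᵥ Pi.single y 1) ⬝ᵥ
        (((P j)ᵀ * H (j + 1) * P j - H j) *ᵥ (minOp (H j) (Qc j) *ᵥ Pi.single y 1)) ≤ cst * θ ^ j)
    (hB : ∀ j a b, |effForm (H j) (Qc j) a b| ≤ B)
    (he : ∀ j, 0 ≤ e j ∧ e j ≤ E₀ * θp ^ j) (hτ : ∀ j, 0 ≤ τ j ∧ τ j ≤ M₀ * θm ^ j)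
    (hN : ∀ j a b, |((minOp (H j) (Qc j))ᵀ * G j * minOp (H j) (Qc j)) a b| ≤ N₀ * Λ ^ j)
    (hθ : 0 < θ) (hθ1 : θ < 1) (hθp : 0 ≤ θp) (hθpθ : θp ≤ θ) (hE₀ : 0 ≤ E₀) (hN₀ : 0 ≤ N₀) (hΛ : 0 ≤ Λ)
    (hrate : θm ^ 2 * Λ ≤ θ ^ 2) :
    ∃ Sinf : Matrix c c ℝ, ∀ a b : c, Tendsto (fun j => effForm (H j) (Qc j) a b) atTop (𝓝 (Sinf a b)) ∧
      ∀ j, |effForm (H j) (Qc j) a b - Sinf a b| ≤ (cst + 2 * (1 + 2 * E₀) * B + 4 * (M₀ ^ 2 * N₀ * Λ)) * θ ^ j / (1 - θ) := by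
  have hEND := towerEnd_of_stabFamily_of_schedules hH hk hcomp hPQ hG hstab hcons hB he hτ hN hθ hθ1.le hθp hθpθ hE₀ hN₀ hΛ hrate
  have hlim : ∀ a b : c, ∃ l : ℝ, Tendsto (fun j => effForm (H j) (Qc j) a b) atTop (𝓝 l) ∧
      ∀ j, |effForm (H j) (Qc j) a b - l| ≤ (cst + 2 * (1 + 2 * E₀) * B + 4 * (M₀ ^ 2 * N₀ * Λ)) * θ ^ j / (1 - θ) := fun a b =>
    exists_limit_of_step_rate_real (fun j => effForm (H j) (Qc j) a b) hθ1 fun j => hEND j a b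
  exact ⟨fun a b => (hlim a b).choose, fun a b => (hlim a b).choose_spec⟩

end Limit

end Summit.QuantumFields.BalabanUV.Beta.GAN24.DerivativeRateTransferLoewnerGramSchedule

end
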